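import Summits.CriticalPhenomena.PercolationContinuityZ3.Theorems.PercNearOneGluingNoHeavyLowerTailQuantitativeBHKExact
import HarnessLib

/-!
# Exactness criterion for the two-cluster repulsion of connection events: the `iff`

Support file (`--supports stmt-CriticalPhenomena-4575`), prover seat `prim-rate-mine-2` (lane prim-rate, constants-miner (c), BENCH row
M2-R15; `run/shared/lean/prim/prim-rate/prim-rate-mine-2/CANDIDATES.md` §gen-3, PROOFS.md §P13).  No definitions, no named facts, no sorries;
standard axioms.

Packaging of `QuantBHK.twoCluster_repulsion_openConn_pos` (strictness) and `QuantBHK.twoCluster_repulsion_openConn_eq_of_separated`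
(conditional independence, used once as stated and once with `(s,a) ↔ (t,o)` exchanged): for weights NON-DEGENERATE on their support `E`
(`w = 0` off `E`, `0 < w < 1` on `E`), `s ≠ t`, `a, o ∉ {s,t}`, and `Γ'` the pairs of `E` avoiding `s, t`,

  `μ(D)·μ(D ∩ {s↔a} ∩ {t↔o}) < μ(D ∩ {s↔a})·μ(D ∩ {t↔o})`   ⟺   `a ⇝ o` in `Γ'`, some `Γ'`-mate `u` of `a` has `su ∈ E`, and some `Γ'`-mate `k` of `a` has `tk ∈ E`

(`D = {s ↮ t}`), i.e. van den Berg–Kahn's (2001, Thm 1.1) / van den Berg–Häggström–Kahn's (2006, eq. (2)) conditional negative correlation of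
`{s↔a}` and `{t↔o}` given `{s↮t}` is STRICT exactly when `a` and `o` lie in one connected component of the support graph minus `{s,t}` that is
adjacent to both `s` and `t`, and is an EQUALITY (conditional independence) otherwise — `QuantBHK.twoCluster_repulsion_openConn_pos_iff`.
[cite: VandenbergKahn2001, Thm. 1.1 (p. 1)] [cite: VandenbergHaggstromKahn2005, Thm. 1.4 and eq. (2) (pp. 2, 7)]
-/

noncomputable section

namespace Summit.CriticalPhenomena.PercolationContinuityZ3.Theorems

open MeasureTheory Set Literature.Probability.LatticeModels Literature.Probability.Percolation
open scoped Classical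

namespace QuantBHK

universe v

variable {V : Type v} [Fintype V]

/-- **Exactness criterion for the repulsion of connection events (van den Berg–Kahn / BHK eq. (2)): strict iff connected through `Γ − {s,t}`
to both poles.**  Weights non-degenerate on their support `E`, `s ≠ t`, `a, o ∉ {s, t}`, `Γ' = {f ∈ E : s, t ∉ f}`, `D = {s ↮ t}`:
`μ(D)·μ(D ∩ {s↔a} ∩ {t↔o}) < μ(D ∩ {s↔a})·μ(D ∩ {t↔o})` iff `a ⇝ o` in `Γ'` and `∃ u, su ∈ E ∧ a ⇝ u` and `∃ k, tk ∈ E ∧ a ⇝ k`; when the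
condition fails the two sides are EQUAL (BHK's inequality gives `≤` always).  BENCH row M2-R15 (prim-rate lane).
[cite: VandenbergKahn2001, Thm. 1.1 (p. 1)] [cite: VandenbergHaggstromKahn2005, eq. (2) (p. 2)] -/
theorem twoCluster_repulsion_openConn_pos_iff (w : Sym2 V → unitInterval) (E : Set (Sym2 V))
    (hE0 : ∀ f, f ∉ E → (w f : ℝ) = 0) (hE1 : ∀ f ∈ E, 0 < (w f : ℝ) ∧ (w f : ℝ) < 1)
    (s t a o : V) (hst : s ≠ t) (ha : a ≠ s ∧ a ≠ t) (ho : o ≠ s ∧ o ≠ t) :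
    (prodBernoulli w).real {ω : BondConfig V | ¬ (openGraph ω).Reachable s t} *
        (prodBernoulli w).real ({ω : BondConfig V | ¬ (openGraph ω).Reachable s t} ∩ openConn s a ∩ openConn t o) <
      (prodBernoulli w).real ({ω : BondConfig V | ¬ (openGraph ω).Reachable s t} ∩ openConn s a) *
        (prodBernoulli w).real ({ω : BondConfig V | ¬ (openGraph ω).Reachable s t} ∩ openConn t o) ↔
    ((openGraph {f | f ∈ E ∧ s ∉ f ∧ t ∉ f}).Reachable a o ∧
      (∃ u, s(s, u) ∈ E ∧ (openGraph {f | f ∈ E ∧ s ∉ f ∧ t ∉ f}).Reachable a u) ∧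
      (∃ k, s(t, k) ∈ E ∧ (openGraph {f | f ∈ E ∧ s ∉ f ∧ t ∉ f}).Reachable a k)) := by
  set μ := prodBernoulli w with hμ
  set D : Set (BondConfig V) := {ω : BondConfig V | ¬ (openGraph ω).Reachable s t} with hD
  set Γ' : Set (Sym2 V) := {f | f ∈ E ∧ s ∉ f ∧ t ∉ f} with hΓ'
  constructor
  · -- strict ⇒ the graph condition (contrapositive: otherwise the two sides are equal)
    intro hlt
    by_contra hcond
    have heq : μ.real D * μ.real (D ∩ openConn s a ∩ openConn t o) =
        μ.real (D ∩ openConn s a) * μ.real (D ∩ openConn t o) := by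
      by_cases hA : (openGraph Γ').Reachable a o
      · by_cases hC : ∃ k, s(t, k) ∈ E ∧ (openGraph Γ').Reachable a k
        · -- then `B` fails: no `Γ'`-mate of `a` is an `E`-neighbour of `s`; use the criterion with `(s,a) ↔ (t,o)` exchanged
          have hB : ∀ u, s(s, u) ∈ E → ¬ (openGraph Γ').Reachable a u := by
            intro u hsu hau
            exact hcond ⟨hA, ⟨u, hsu, hau⟩, hC⟩
          have hΓ : ({f | f ∈ E ∧ t ∉ f ∧ s ∉ f} : Set (Sym2 V)) = Γ' := by
            ext f; simp only [hΓ', Set.mem_setOf_eq]; tauto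
          have hsep' : ¬ (openGraph {f | f ∈ E ∧ t ∉ f ∧ s ∉ f}).Reachable o a ∨
              ∀ y, (openGraph {f | f ∈ E ∧ t ∉ f ∧ s ∉ f}).Reachable o y → s(s, y) ∉ E := by
            rw [hΓ]
            exact Or.inr fun y hoy hsy => hB y hsy (hA.trans hoy)
          have h := twoCluster_repulsion_openConn_eq_of_separated w E hE0 t s o a hst.symm ho.symm ⟨ha.2, ha.1⟩ hsep'
          have hD' : ({ω : BondConfig V | ¬ (openGraph ω).Reachable t s} : Set (BondConfig V)) = D := by
            ext ω
            simp only [hD, Set.mem_setOf_eq]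
            exact ⟨fun h h' => h h'.symm, fun h h' => h h'.symm⟩
          rw [hD', ← hμ] at h
          rw [show D ∩ openConn s a ∩ openConn t o = D ∩ openConn t o ∩ openConn s a from by
            rw [Set.inter_assoc, Set.inter_comm (openConn s a), ← Set.inter_assoc]]
          rw [h, mul_comm]
        · have h := twoCluster_repulsion_openConn_eq_of_separated w E hE0 s t a o hst ha ho
            (Or.inr fun y hy hty => hC ⟨y, hty, hy⟩)
          rw [← hμ] at h
          exact h
      · have h := twoCluster_repulsion_openConn_eq_of_separated w E hE0 s t a o hst ha ho (Or.inl hA)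
        rw [← hμ] at h
        exact h
    exact absurd heq (ne_of_lt hlt)
  · -- the graph condition ⇒ strict
    rintro ⟨hao, ⟨u, hsu, hau⟩, ⟨k, htk, hak⟩⟩
    have h := twoCluster_repulsion_openConn_pos w E hE0 hE1 s t a o u k hst ha ho hsu htk hau.symm (hau.symm.trans hao)
      (hak.symm.trans hao)
    rw [← hμ] at h
    exact h

end QuantBHK

end Summit.CriticalPhenomena.PercolationContinuityZ3.Theorems
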